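import Summits.Parity.GeneralizedHardyLittlewood.Theorems.FordMaynardSieveConst01651SieveConst01651Dim5Check
import HarnessLib

/-!
# Route `FordMaynardSieveConst01651`, target `SieveConst01651` (stmt-Parity-19185), stub `stub_coneCertClosed`,
# residue `h5`: kernel evaluation of the dimension-5 type checker — chunks `a₀ = 1, 2`

Def-free helper file.  Each `dim5CheckFrom a₀ = true` is established by KERNEL evaluation (`decide +kernel`, standard
axioms, no `native_decide`): the pruned enumeration of all types with smallest cell `a₀`, ten packed-table lookups per
type, and the integer Farkas re-check of the certified-empty ones.  Types per chunk (counted outside Lean by a bit-exact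
mirror of the checker): `a₀ = 0: 19145, 1: 15180, 2: 12194, 3: 9738, 4: 7655, 5: 5864, 6: 4391, 7: 3160, 8: 2193, 9: 1417,
10: 850, 11: 428, 12: 160, 13: 46, 14: 7` (82 428 in all); measured ≈ 4–7 ms of kernel time per type (`a₀ = 0`: 129 s).

References: [FordMaynard2024PrimeSieves] arXiv:2407.14368, Theorem 7.3 (a), §8.2.
-/

namespace Summit.Parity.GeneralizedHardyLittlewood.FordMaynardSieveConst01651SieveConst01651

/-- All dimension-5 types with smallest cell `a₀ = 1` pass the checker (kernel evaluation). [folklore] -/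
theorem dim5CheckFrom_1 : dim5CheckFrom 1 = true := by decide +kernel

/-- All dimension-5 types with smallest cell `a₀ = 2` pass the checker (kernel evaluation). [folklore] -/
theorem dim5CheckFrom_2 : dim5CheckFrom 2 = true := by decide +kernel

end Summit.Parity.GeneralizedHardyLittlewood.FordMaynardSieveConst01651SieveConst01651
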